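import Mathlib
import Summits.MatrixMultiplication.MatrixMultiplication.Theorems.SnSubsetDichotomyPolynomialSlackPairCollision
import Summits.MatrixMultiplication.MatrixMultiplication.Theorems.SnSubsetDichotomyPolynomialSlackMarginals

/-!
# Sharp heavy-mass bound for the normalised pair marginal of a quotient set

Crux `Summit.MatrixMultiplication.MatrixMultiplication.Theses.SnSubsetDichotomy.PolynomialSlack`
(item `stmt-MatrixMultiplication-8306`), helper file of lead c6 (line `transport-split-hull`, programme
BEYOND ONE HALF), level-one programme. For `X, Y ⊆ S_n` nonempty with `(x,y) ↦ x⁻¹y` injective on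
`X × Y` put `α = |X||Y|` and let `d(i,j) = m_{XY}(i,j)/α` be the normalised pair marginal
(`m_{XY}(i,j) = #{(x,y) ∈ X × Y : y j = x i}`), i.e. the normalised marginal of the quotient SET
`A = X⁻¹Y` (`|A| = α` by `card_image₂_of_injOn'`, `m_{XY}(i,j) = #{a ∈ A : a j = i}` by
`pairMarginal_eq_marginal_image₂`). For a level `θ > 0` let `S_θ = Σ_{d(i,j) ≥ θ} d(i,j)` be the HEAVY
MASS. Then

  `S_θ ≤ 1 + (S_θ/θ)²·(n-2)!/α`      (`pair_heavy_mass_sharp`):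

for the set `H` of heavy cells the pair-collision bound `heavy_mass_le_card_add` gives
`Σ_{(i,j) ∈ H} m(i,j) ≤ |A| + |H|²·(n-2)!`, i.e. `S_θ ≤ 1 + |H|²·(n-2)!/α`, and `|H|·θ ≤ S_θ`.
-/

namespace Summit.MatrixMultiplication.MatrixMultiplication.Theorems.PolynomialSlack

set_option linter.dupNamespace false

open scoped BigOperators

/-- **Sharp heavy-mass bound.** For nonempty `X, Y ⊆ S_n` with `(x,y) ↦ x⁻¹y` injective on `X × Y`,
normalised pair marginal `d(i,j) = #{(x,y) ∈ X × Y : y j = x i}/(|X||Y|)` and a level `θ > 0`, the heavy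
mass `S_θ = Σ_{i,j : d(i,j) ≥ θ} d(i,j)` satisfies `S_θ ≤ 1 + (S_θ/θ)²·(n-2)!/(|X||Y|)`: the heavy cells
`H` number at most `S_θ/θ` (each carries mass `≥ θ`), and by the pair-collision bound
`heavy_mass_le_card_add` for the quotient set `A = X⁻¹Y` (`|A| = |X||Y|`, marginals `m_{XY}`) the
`H`-mass of `A` is at most `|A| + |H|²·(n-2)!`. [folklore] -/
theorem pair_heavy_mass_sharp {n : ℕ} (X Y : Finset (Equiv.Perm (Fin n))) (hX : X.Nonempty)
    (hY : Y.Nonempty)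
    (hinj : Set.InjOn (fun xy : Equiv.Perm (Fin n) × Equiv.Perm (Fin n) => xy.1⁻¹ * xy.2)
      (↑X ×ˢ ↑Y : Set (Equiv.Perm (Fin n) × Equiv.Perm (Fin n))))
    (d : Fin n → Fin n → ℝ)
    (hd : ∀ i j, d i j = (((X ×ˢ Y).filter fun xy => xy.2 j = xy.1 i).card : ℝ) / (X.card * Y.card : ℕ))
    (θ : ℝ) (hθ : 0 < θ) :
    ∑ i : Fin n, ∑ j : Fin n, (if θ ≤ d i j then d i j else 0) ≤
      1 + ((∑ i : Fin n, ∑ j : Fin n, (if θ ≤ d i j then d i j else 0)) / θ) ^ 2 *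
        (n - 2).factorial / (X.card * Y.card : ℕ) := by
  classical
  -- `α = |X||Y| > 0`
  have hα : (0 : ℝ) < ((X.card * Y.card : ℕ) : ℝ) := by
    exact_mod_cast Nat.mul_pos hX.card_pos hY.card_pos
  -- the heavy cells
  set H : Finset (Fin n × Fin n) := Finset.univ.filter fun p => θ ≤ d p.1 p.2 with hH
  -- the heavy mass as a sum over `H`
  have hS : ∑ i : Fin n, ∑ j : Fin n, (if θ ≤ d i j then d i j else 0) = ∑ p ∈ H, d p.1 p.2 := by
    rw [hH, Finset.sum_filter, Fintype.sum_prod_type]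
  -- ... and as the normalised `H`-mass of the pair marginal
  have hSm : ∑ p ∈ H, d p.1 p.2 =
      (∑ p ∈ H, (((X ×ˢ Y).filter fun xy => xy.2 p.2 = xy.1 p.1).card : ℝ)) /
        (X.card * Y.card : ℕ) := by
    rw [Finset.sum_div]
    exact Finset.sum_congr rfl fun p _ => hd p.1 p.2
  -- the pair-collision bound for the quotient set `A = X⁻¹Y`, transported to `m_{XY}` and cast to `ℝ`
  have hmass : (∑ p ∈ H, (((X ×ˢ Y).filter fun xy => xy.2 p.2 = xy.1 p.1).card : ℝ)) ≤
      (X.card * Y.card : ℕ) + (H.card : ℝ) ^ 2 * (n - 2).factorial := by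
    have h := heavy_mass_le_card_add (Finset.image₂ (fun x y : Equiv.Perm (Fin n) => x⁻¹ * y) X Y) H
    rw [card_image₂_of_injOn' hinj] at h
    simp_rw [← pairMarginal_eq_marginal_image₂ hinj] at h
    exact_mod_cast h
  -- `|H|·θ ≤ S_θ`
  have hHS : (H.card : ℝ) * θ ≤ ∑ p ∈ H, d p.1 p.2 := by
    rw [← nsmul_eq_mul, ← Finset.sum_const]
    exact Finset.sum_le_sum fun p hp => (Finset.mem_filter.1 hp).2
  rw [hS]
  set S := ∑ p ∈ H, d p.1 p.2
  have hHle : (H.card : ℝ) ≤ S / θ := by rwa [le_div_iff₀ hθ]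
  calc S = (∑ p ∈ H, (((X ×ˢ Y).filter fun xy => xy.2 p.2 = xy.1 p.1).card : ℝ)) /
        (X.card * Y.card : ℕ) := hSm
    _ ≤ ((X.card * Y.card : ℕ) + (H.card : ℝ) ^ 2 * (n - 2).factorial) / (X.card * Y.card : ℕ) :=
        div_le_div_of_nonneg_right hmass hα.le
    _ = 1 + (H.card : ℝ) ^ 2 * (n - 2).factorial / (X.card * Y.card : ℕ) := by
        rw [add_div, div_self hα.ne']
    _ ≤ 1 + (S / θ) ^ 2 * (n - 2).factorial / (X.card * Y.card : ℕ) := by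
        gcongr

end Summit.MatrixMultiplication.MatrixMultiplication.Theorems.PolynomialSlack
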